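import Summits.QuantumFields.BalabanUV.T4Continuum.Spine.NE3.LandauCorrectionSupB8Flat
import Summits.QuantumFields.BalabanUV.T4Continuum.Spine.NE3.SlicePoincareSlicB8Flat
import HarnessLib

/-!
# T⁴ programme, node NE3 — census R35: ON THE UNIT TORUS (`N = 1`) THE (1.38)-PROJECTION FACT (HR) IS ELEMENTARY (`c_R = 2`), SO THE FLAT-DATUM `hK`
# THERE FOLLOWS FROM THE SUP-REGULARITY (H0) ALONE — `LandauCorrectionSupB8` at `W = 1`, `N = 1`, every `L ≥ 2`, `j`, with `K₀ = 12d·liftC·c₀`, `K₁ = 12d·liftC·c₁`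

Cell `pub-balaban-gaps` (YM blitz, track G2, seat `ne3`, unit `pub-balaban-gaps-ne3`; writer prover-pub-balaban-gaps-ne3-g7-0, 2026-08-24), census
`run/shared/lean/pub/pub-balaban-gaps/ne/NE3.md` §4 R35, §13.  WHY.  `LandauCorrectionSupB8Flat.landauCorrectionSupB8_flatCfg_of_supFacts` reduces the END's sup letter
`hK` at the flat datum to (H0) (sup-regularity of `Δ_1` on `N(Q′(1))`, [B6] (2.67) e0∕e1 TYPE) and (HR) (the `ℓ^∞` bound of B8's projection `R(1)` onto `Δ_1N(Q′(1))`,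
[B9] (3.25)∕(3.49) TYPE).  On the UNIT torus (`N = 1`: one block = the whole torus, gen 5's R30 setting) B8's test space `N(Q′(1))` is ALL skew periodic mean-zero site
fields, so `Δ_1N(Q′(1))` is everything `Δ_1` reaches and (HR) is elementary: if `g := F + Δ_1μ ⊥ Δ_1ν` for every mean-zero `ν`, test against `ν := g − mean g`
(`mean g = mean F` since `Σ Δ_1μ = 0`): `Σ‖D_1ν‖² = Σ hsR (Δ_1ν) ν = Σ hsR (g)(Δ_1ν) − hsR (Σ Δ_1ν) (mean F) = 0`, the k-free corner-gauge Poincaré inequality of `N(Q′)`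
(`NE3CornerGaugePoincare`) forces `ν = 0`, i.e. `Δ_1μ = mean F − F`, whence `‖Δ_1μ‖_∞ ≤ 2‖F‖_∞` — the argument of gen 5's `covDiv_eq_zero_of_isLandauB8_flatCfg_unit` with
a source.  What is NOT elementary even at `N = 1` is (H0) (`‖u‖_∞ ≤ c₀M²‖Δ_1u‖_∞` on mean-zero fields of the `M^d`-torus UNIFORMLY in `M`: pointwise Green's-function
bounds, [Balaban1983RegularityDecay]-type content; the energy∕Fourier–Cauchy–Schwarz route loses `(log M)^{1∕2}` in `d = 4`).

CONTENT (0 sorry; no `def`; [folklore]): §1 `norm_mean_le` (the mean over the period box is bounded by the sup), `sum_covLapSite_flatCfg_eq_zero` (`Σ_{box} Δ_1μ = 0`);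
§2 **`covLapSite_sup_le_two_mul_flatCfg_unit`** ((HR) at `N = 1` with `c_R = 2`); §3 **`landauCorrectionSupB8_flatCfg_unit_of_supRegularity`** (`hK` at `W = 1`,
`N = 1` ⇐ (H0) alone).

HONEST FRAMING.  A CONDITIONAL statement at the TRIVIAL background on the UNIT torus; (H0) NOT proved; nothing about curved backgrounds or Bałaban's minimisers; `hK`
over `sfClass`, (P♮) at curved `W`, `PairLandauGaugeB8Avg`, the covariant root and **NE3 are NOT proved**; spine PROVED 0∕9; finite T⁴ rung (B)+1 — NOT infinite volume, NOT
mass gap, NOT `BetaPertH`, NOT Clay.  PLACEMENT: `Summits/QuantumFields/BalabanUV/T4Continuum/Spine/NE3/`; imports accepted modules only; moves nothing.  HONEST DEPENDENCY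
(cell page 1): continuum YM on T⁴ ⇐ BetaPertH ∧ nine spine estimates (0/9 proved); BetaPertH ⇐ (D1) ∧ (D4) ∧ CAP+tail; G-an2-4 gates asym, D1 and NE2/3/4.
-/

set_option autoImplicit false

open scoped BigOperators Matrix Matrix.Norms.L2Operator
open NormedSpace Finset

namespace Summit.QuantumFields.BalabanUV.T4Continuum.NE3.LandauCorrectionSupB8FlatUnit

open Literature.MathematicalPhysics.QuantumFieldTheory.Balaban1983to89
open B7Prop1Explicit B7Prop2Explicit
open T4AveragingDeficitWall (IsUnitaryCfg IsSkewDir SmallField)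
open T4AveragingDeficitWallBoundary (IsPeriodicCfg periodBox card_periodBox)
open AveragingDeficitPeriodicCounting (IsPeriodicDir)
open AveragingDeficitMultiLevelPrep (LevelSmall)
open BlockAveragePushDirGauge (gaugeDir isPeriodicDir_gaugeDir)
open MinimalActionWitness (flatCfg isPeriodicCfg_flatCfg)
open MatrixNorms (nhsNormSq nhsNormSq_nonneg)
open NE3QbarIterCovLiftPrep (cruxC liftC)
open NE3CovariantCalculus (hsR hsR_self hsR_comm hsR_sub_right hsR_sum_left)
open NE3CovariantWeitzenbock (covDiv)
open NE3CovariantBlockMean (bmeanIterW)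
open NE3LandauOrbit (covDiv_add_period eq_zero_of_nhsNormSq_eq_zero hsR_zero_left gaugeDir_skew)
open NE3CurvedCornerGaugeSpace (covDiv_mem_skewAdjoint)
open NE3CornerGaugePoincare (sum_nhsNormSq_le_four_mul_of_bmeanIterW_eq_zero)
open NE3FrameFreeSliceUnique (eq_zero_of_periodic_of_box)
open NE3FlatHessianCurl (isUnitaryCfg_flatCfg smallField_flatCfg_zero)
open NE3.PairLandauB8 (avgKernelGauges covLapSite)
open NE3.LandauProjectionB8 (covDiv_gaugeDir_eq_covLapSite covLapSite_add_period sum_nhsNormSq_gaugeDir_eq)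
open NE3.LandauProjectionSupShape (LandauCorrectionSupB8)
open NE3.SlicePoincareSlicB8Flat (levelSmall_zero cornerSmall_zero bmeanIterW_flatCfg_eq_zero_of_sum_eq_zero sum_covDiv_flatCfg_eq_zero)
open NE3.LandauCorrectionSupB8Flat (landauCorrectionSupB8_flatCfg_of_supFacts)

noncomputable section

variable {d : ℕ} {n : Type*} [Fintype n] [DecidableEq n]

/-! ## §1 Two bookkeeping facts on the period box -/

/-- The mean of a site field over the period box is bounded by its sup. [folklore] -/
theorem norm_mean_le {P : ℕ} (hP : 1 ≤ P) (F : Site d → Matrix n n ℂ) {B : ℝ} (hFB : ∀ y : Site d, ‖F y‖ ≤ B) :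
    ‖(((P : ℝ) ^ d)⁻¹) • ∑ y ∈ periodBox (d := d) P, F y‖ ≤ B := by
  have hPd : (0 : ℝ) < (P : ℝ) ^ d := by positivity
  have hcard : ((periodBox (d := d) P).card : ℝ) = (P : ℝ) ^ d := by rw [card_periodBox]; push_cast; ring
  have h1 : ‖∑ y ∈ periodBox (d := d) P, F y‖ ≤ (P : ℝ) ^ d * B := by
    refine (norm_sum_le _ _).trans ?_
    calc ∑ y ∈ periodBox (d := d) P, ‖F y‖ ≤ ∑ _y ∈ periodBox (d := d) P, B := Finset.sum_le_sum fun y _ => hFB y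
      _ = (P : ℝ) ^ d * B := by rw [Finset.sum_const, nsmul_eq_mul, hcard]
  rw [norm_smul, norm_inv, Real.norm_of_nonneg hPd.le]
  rw [inv_mul_le_iff₀ hPd]
  exact h1

/-- `Σ_{x ∈ periodBox P} Δ_1 μ x = 0` for a `P`-periodic generator (the flat Laplacian is a divergence: `Δ_1 = covDiv_1 ∘ D_1`). [folklore] -/
theorem sum_covLapSite_flatCfg_eq_zero {P : ℕ} (hP : 1 ≤ P) {mu : Site d → Matrix n n ℂ}
    (hmuP : ∀ (y : Site d) (i : Fin d), mu (y + (P : ℤ) • e i) = mu y) :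
    ∑ x ∈ periodBox (d := d) P, covLapSite (flatCfg (d := d) (n := n)) mu x = 0 := by
  rw [← covDiv_gaugeDir_eq_covLapSite]
  exact sum_covDiv_flatCfg_eq_zero hP (isPeriodicDir_gaugeDir (isPeriodicCfg_flatCfg _) hmuP)

/-! ## §2 (HR) on the unit torus: `F + Δ_1μ ⊥ Δ_1N(Q′(1))` forces `‖Δ_1μ‖_∞ ≤ 2‖F‖_∞` -/

/-- **(HR) AT `N = 1`, `W = 1`, WITH `c_R = 2`**: for `L ≥ 2`, a skew `L^{j+1}`-periodic site field `F` with `‖F‖_∞ ≤ B`, and `μ ∈ N(Q′(1))` (`avgKernelGauges L 1 (j+1) 1`)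
with `Σ_{x ∈ periodBox L^{j+1}} hsR (F x + Δ_1μ x) (Δ_1ν x) = 0` for every `ν ∈ N(Q′(1))`: `‖Δ_1μ(y)‖ ≤ 2B` at every site (indeed `Δ_1μ = mean F − F`). [folklore] -/
theorem covLapSite_sup_le_two_mul_flatCfg_unit [Nonempty n] {L : ℕ} (hL : 2 ≤ L) (j : ℕ)
    (F : Site d → Matrix n n ℂ) (hFs : ∀ y : Site d, F y ∈ skewAdjoint (Matrix n n ℂ))
    (hFP : ∀ (y : Site d) (i : Fin d), F (y + ((1 * L ^ (j + 1) : ℕ) : ℤ) • e i) = F y)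
    {mu : Site d → Matrix n n ℂ} (hmu : mu ∈ avgKernelGauges (d := d) (n := n) L 1 (j + 1) (flatCfg (d := d) (n := n)))
    (horth : ∀ nu ∈ avgKernelGauges (d := d) (n := n) L 1 (j + 1) (flatCfg (d := d) (n := n)),
      ∑ y ∈ periodBox (d := d) (1 * L ^ (j + 1)),
        hsR (F y + covLapSite (flatCfg (d := d) (n := n)) mu y) (covLapSite (flatCfg (d := d) (n := n)) nu y) = 0)
    {B : ℝ} (hFB : ∀ y : Site d, ‖F y‖ ≤ B) (y : Site d) :
    ‖covLapSite (flatCfg (d := d) (n := n)) mu y‖ ≤ 2 * B := by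
  have hL1 : 1 ≤ L := by omega
  set P : ℕ := 1 * L ^ (j + 1) with hPdef
  have hPM : P = L ^ (j + 1) := Nat.one_mul _
  have hP : 1 ≤ P := by rw [hPM]; exact Nat.one_le_pow _ _ (by omega)
  have hWu : IsUnitaryCfg (flatCfg (d := d) (n := n)) := isUnitaryCfg_flatCfg
  have hWP : IsPeriodicCfg (flatCfg (d := d) (n := n)) (P : ℤ) := isPeriodicCfg_flatCfg _
  obtain ⟨hmus, hmuP, -⟩ := hmu
  -- `g := F + Δ_1μ`, its mean `c = mean F`, and the test generator `ν := g − c`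
  set g : Site d → Matrix n n ℂ := fun x => F x + covLapSite (flatCfg (d := d) (n := n)) mu x with hgdef
  set c : Matrix n n ℂ := (((P : ℝ) ^ d)⁻¹) • ∑ x ∈ periodBox (d := d) P, F x with hcdef
  set nu : Site d → Matrix n n ℂ := fun x => g x - c with hnudef
  have hlapP : ∀ (x : Site d) (i : Fin d), covLapSite (flatCfg (d := d) (n := n)) mu (x + (P : ℤ) • e i) = covLapSite (flatCfg (d := d) (n := n)) mu x :=
    covLapSite_add_period hWP hmuP
  have hlaps : ∀ x : Site d, covLapSite (flatCfg (d := d) (n := n)) mu x ∈ skewAdjoint (Matrix n n ℂ) := by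
    intro x
    rw [← covDiv_gaugeDir_eq_covLapSite]
    exact covDiv_mem_skewAdjoint hWu (gaugeDir_skew hWu hmus) x
  have hgP : ∀ (x : Site d) (i : Fin d), g x = g (x + (P : ℤ) • e i) := fun x i => by
    simp only [hgdef, hFP x i, hlapP x i]
  have hgs : ∀ x : Site d, g x ∈ skewAdjoint (Matrix n n ℂ) := fun x => (skewAdjoint _).add_mem (hFs x) (hlaps x)
  have hcs : c ∈ skewAdjoint (Matrix n n ℂ) := by
    rw [hcdef]
    exact skewAdjoint.smul_mem _ ((skewAdjoint _).sum_mem fun x _ => hFs x)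
  have hnuP : ∀ (x : Site d) (i : Fin d), nu (x + (P : ℤ) • e i) = nu x := fun x i => by
    simp only [hnudef, ← hgP x i]
  have hnus : ∀ x : Site d, nu x ∈ skewAdjoint (Matrix n n ℂ) := fun x => (skewAdjoint _).sub_mem (hgs x) hcs
  -- `Σ_{box} Δ_1μ = 0`, hence `Σ_{box} g = Σ_{box} F = P^d • c` and `Σ_{box} ν = 0`
  have hsumLap : ∑ x ∈ periodBox (d := d) P, covLapSite (flatCfg (d := d) (n := n)) mu x = 0 := sum_covLapSite_flatCfg_eq_zero hP hmuP
  have hPd : ((P : ℝ) ^ d) ≠ 0 := by positivity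
  have hcard : ((periodBox (d := d) P).card : ℝ) = (P : ℝ) ^ d := by rw [card_periodBox]; push_cast; ring
  have hsumnu : ∑ x ∈ periodBox (d := d) P, nu x = 0 := by
    simp only [hnudef, hgdef, Finset.sum_sub_distrib, Finset.sum_add_distrib, hsumLap, add_zero, Finset.sum_const, hcdef]
    rw [show ((periodBox (d := d) P).card • ((((P : ℝ) ^ d)⁻¹) • ∑ x ∈ periodBox (d := d) P, F x))
        = (((periodBox (d := d) P).card : ℝ) * (((P : ℝ) ^ d)⁻¹)) • ∑ x ∈ periodBox (d := d) P, F x by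
      rw [← smul_smul, Nat.cast_smul_eq_nsmul]]
    rw [hcard, mul_inv_cancel₀ hPd, one_smul, sub_self]
  -- `ν ∈ N(Q′(1))`
  have hnuP' : ∀ (x : Site d) (i : Fin d), nu (x + ((L ^ (j + 1) : ℕ) : ℤ) • e i) = nu x := by rw [← hPM]; exact hnuP
  have hnumean : bmeanIterW L (j + 1) (flatCfg (d := d) (n := n)) nu = 0 :=
    bmeanIterW_flatCfg_eq_zero_of_sum_eq_zero hL1 j hnuP' (by rw [← hPM]; exact hsumnu)
  have hnuN : nu ∈ avgKernelGauges (d := d) (n := n) L 1 (j + 1) (flatCfg (d := d) (n := n)) := ⟨hnus, hnuP, hnumean⟩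
  -- test the orthogonality against `ν`: `Σ‖D_1ν‖² = Σ hsR (Δν) ν = Σ hsR g (Δν) − hsR (Σ Δν) c = 0`
  have h0 := horth nu hnuN
  have hnulapP : ∀ (x : Site d) (i : Fin d), covLapSite (flatCfg (d := d) (n := n)) nu (x + (P : ℤ) • e i) = covLapSite (flatCfg (d := d) (n := n)) nu x :=
    covLapSite_add_period hWP hnuP
  have hsumLapnu : ∑ x ∈ periodBox (d := d) P, covLapSite (flatCfg (d := d) (n := n)) nu x = 0 := sum_covLapSite_flatCfg_eq_zero hP hnuP
  have h1 : ∑ x ∈ periodBox (d := d) P, ∑ κ : Fin d, nhsNormSq (gaugeDir (flatCfg (d := d) (n := n)) nu x κ) = 0 := by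
    rw [sum_nhsNormSq_gaugeDir_eq hP hWu hWP hnuP]
    have h2 : ∀ x : Site d, hsR (covLapSite (flatCfg (d := d) (n := n)) nu x) (nu x)
        = hsR (g x) (covLapSite (flatCfg (d := d) (n := n)) nu x) - hsR (covLapSite (flatCfg (d := d) (n := n)) nu x) c := by
      intro x
      rw [hnudef, hsR_sub_right, hsR_comm]
    simp only [h2, Finset.sum_sub_distrib, ← hsR_sum_left, hsumLapnu, hsR_zero_left, sub_zero]
    exact h0
  -- the corner-gauge Poincaré inequality of `N(Q′)` forces `ν = 0`
  have hK := sum_nhsNormSq_le_four_mul_of_bmeanIterW_eq_zero hL j hWu le_rfl (levelSmall_zero hL j) smallField_flatCfg_zero 1 nu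
    (fun z _ => by rw [hnumean]; rfl) (cornerSmall_zero (n := n) L j)
  rw [show L ^ (j + 1) * 1 = P by rw [hPM, Nat.mul_one], h1, mul_zero, mul_zero] at hK
  have hbox : ∀ x ∈ periodBox (d := d) P, nu x = 0 := by
    have hle := (Finset.sum_eq_zero_iff_of_nonneg fun x _ => nhsNormSq_nonneg (nu x)).1
      (le_antisymm hK (Finset.sum_nonneg fun x _ => nhsNormSq_nonneg (nu x)))
    exact fun x hx => eq_zero_of_nhsNormSq_eq_zero (hle x hx)
  have hnu0 : nu y = 0 := eq_zero_of_periodic_of_box hP hnuP hbox y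
  -- `Δ_1μ y = c − F y`
  have hlap : covLapSite (flatCfg (d := d) (n := n)) mu y = c - F y := by
    have : F y + covLapSite (flatCfg (d := d) (n := n)) mu y - c = 0 := hnu0
    rw [← sub_eq_zero]; rw [← this]; abel
  rw [hlap]
  calc ‖c - F y‖ ≤ ‖c‖ + ‖F y‖ := norm_sub_le _ _
    _ ≤ B + B := add_le_add (norm_mean_le hP F hFB) (hFB y)
    _ = 2 * B := by ring

/-! ## §3 The flat-datum `hK` on the unit torus from (H0) alone -/

/-- **`hK` AT `W = 1` ON THE UNIT TORUS FROM THE SUP-REGULARITY (H0) ALONE** (every `d`, `L ≥ 2`, `j`; `N = 1`, `M = L^{j+1}`): if every `u ∈ N(Q′(1))` (here: skew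
`M`-periodic mean-zero site fields) with `‖Δ_1u‖_∞ ≤ B` satisfies `‖u‖_∞ ≤ c₀M²B` and `‖D_1u‖_∞ ≤ c₁MB` ([B6] (2.67) entries e0∕e1 at `U = 1` on the `M^d`-torus, TYPE,
NOT proved here), then `LandauCorrectionSupB8 hL j hWu hx hs hWx 1 hθ (12d·liftC·c₀) (12d·liftC·c₁)` — §2 supplies (HR) with `c_R = 2`. [folklore] -/
theorem landauCorrectionSupB8_flatCfg_unit_of_supRegularity [Nonempty n] {L : ℕ} (hL : 2 ≤ L) (j : ℕ) {x : ℝ}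
    (hWu : IsUnitaryCfg (flatCfg (d := d) (n := n))) (hx : 0 ≤ x) (hs : LevelSmall d L j x) (hWx : SmallField (flatCfg (d := d) (n := n)) x)
    (hθ : cruxC d L * (((L : ℝ) ^ (j + 1)) ^ 2 * x) < 1) {c₀ c₁ : ℝ}
    (hG : ∀ u ∈ avgKernelGauges (d := d) (n := n) L 1 (j + 1) (flatCfg (d := d) (n := n)), ∀ B : ℝ,
      (∀ y : Site d, ‖covLapSite (flatCfg (d := d) (n := n)) u y‖ ≤ B) →
        (∀ y : Site d, ‖u y‖ ≤ c₀ * ((L : ℝ) ^ (j + 1)) ^ 2 * B) ∧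
        (∀ (y : Site d) (μ : Fin d), ‖gaugeDir (flatCfg (d := d) (n := n)) u y μ‖ ≤ c₁ * (L : ℝ) ^ (j + 1) * B)) :
    LandauCorrectionSupB8 hL j hWu hx hs hWx 1 hθ (12 * (d : ℝ) * liftC d * c₀) (12 * (d : ℝ) * liftC d * c₁) := by
  have h := landauCorrectionSupB8_flatCfg_of_supFacts (d := d) (n := n) hL j hWu hx hs hWx 1 hθ (c₀ := c₀) (c₁ := c₁) (cR := 2) hG
    (fun F hFs hFP mu hmu horth B hFB y => covLapSite_sup_le_two_mul_flatCfg_unit hL j F hFs hFP hmu horth hFB y)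
  exact LandauCorrectionSupB8.mono hL j hWu hx hs hWx 1 hθ h (le_of_eq (by ring)) (le_of_eq (by ring))

end

end Summit.QuantumFields.BalabanUV.T4Continuum.NE3.LandauCorrectionSupB8FlatUnit
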